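import Summits.BirchSwinnertonDyer.BirchSwinnertonDyer.Theorems.UniversalToricDescentBDPFrameCrossPeriodRigidity
import Summits.BirchSwinnertonDyer.BirchSwinnertonDyer.Theorems.UniversalToricDescentTwinSplitIMCAtThreeSupsetGoodOrd
import HarnessLib

/-!
# Route `UniversalToricDescent`, crux #3 `TwinSplitIMCAtThree` (item stmt-BirchSwinnertonDyer-20214):
# the `⊇`-half at `p = 3` for good-ordinary twins at EVERY frame (the crux's literal currency), and the
# reduction of the crux on such twins (with (disc)) to the `⊆`-half at ONE frame

Seat `bsd-wall-utd-p2` (D-0131 (3) MIDDLE tier; memo `HOME/bsd-wall/bsd-wall-utd-p2/SUPSET-AT3-v1.md`).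
Kernel-checked, sorry-free, CONDITIONAL on ONE named refereed fact (`h421` =
`BurungaleCastellaSkinner2025.thm421b_exists_isBDPLFunction_isTorsion_mem_charIdeal`, IMRN 2025 Thm. 4.2.1
(b), odd `p`). Composition of the landed `exists_frame_isTorsion_mem_charIdeal_of_goodOrd` (the `⊇`-half at
the PRINTED frame) with the integral cross-period rigidity `span_singleton_eq_of_isBDPLFunction`
(companion file `UniversalToricDescentBDPFrameCrossPeriodRigidity.lean`: two frames with arbitrary non-zero
periods generate the same ideal of `R₀⟦T⟧`).

* `forall_frame_supset_of_goodOrd` — for ALL `(Ω_K ≠ 0, Ω_p ≠ 0, L′)` with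
  `IsBDPLFunction ι′ 𝔭 κ γ Dt′.f Ω_K Ω_p L′`: `(L′) ⊆ Ch_Λ(X_ac(W′_K) strict at 𝔭′)·R₀⟦T⟧` — clause (ii)'s
  `⊇`-half EXACTLY as the crux quantifies it, for a twin good ordinary at `3` with `ρ̄₃` onto and `K` with
  `D_K` odd (the `D_K ≠ −3` half of (disc) is automatic: `discr_ne_neg_three_of_degreeOne`) (census
  bucket A: 745 of the 2 023 twin classes).
* `twinSplit_instance_of_goodOrd_of_subset_at_one_frame` — on such a twin, conjuncts (i) ∧ (ii) of
  `TwinSplitIMCAtThree` follow from the `⊆`-half `Ch·R₀⟦T⟧ ⊆ (L₁)` at ONE frame `L₁`: the residual of crux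
  #3 on bucket A is exactly the `p = 3` case of Wan's divisibility ("the only missing ingredient",
  BCS 2025 p. 5), nothing else.

Beyond-print: NO (print + tree rigidity). PARTITION: bucket A `⊇` at every frame; B (675), C (603)
untouched. `--supports stmt-BirchSwinnertonDyer-20214`.

References: [BurungaleCastellaSkinner2025] Thm. 4.2.1 (b) (p. 8) and p. 5 of arXiv:2405.00270v2;
[Castella2018] Thm. 3.1.
-/

noncomputable section

open scoped Classical Topology

set_option linter.dupNamespace false
set_option autoImplicit false

namespace Summit.BirchSwinnertonDyer.BirchSwinnertonDyer.Theorems.UniversalToricDescentTwinSplit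

open Filter PowerSeries WeierstrassCurve NumberField IsDedekindDomain Field
  Literature.NumberTheory.EllipticCurves
  Literature.NumberTheory.EllipticCurves.ModularForms
  Literature.NumberTheory.EllipticCurves.Rank1Residual
  Literature.NumberTheory.GaloisRepresentations
  Summit.BirchSwinnertonDyer.Rank1Residual
  Summit.BirchSwinnertonDyer.Rank1Residual.X11b
  Summit.BirchSwinnertonDyer.Rank1Residual.X11b.Halves
  Summit.BirchSwinnertonDyer.BirchSwinnertonDyer.Theorems.SchneiderFree

/-- **`D_K ≠ −3` is automatic when `3` splits in `K`**: a degree-one prime `𝔭 ∋ 3` of the quadratic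
field `K` forces two primes above `3` (`SchneiderFree.ncard_primesOver_eq_two_of_degreeOne`), hence `3 ∤ D_K`
(tree `not_dvd_discr_of_ncard_primesOver`, Dedekind), whereas `3 ∣ −3`. So of BCS's (disc) only "`D_K` odd"
is an extra hypothesis relative to crux #3's binders. [folklore] -/
theorem discr_ne_neg_three_of_degreeOne {K : Type} [Field K] [NumberField K]
    (hK : IsImaginaryQuadratic K) {𝔭 : HeightOneSpectrum (𝓞 K)} (h𝔭 : ((3 : ℕ) : 𝓞 K) ∈ 𝔭.asIdeal)
    (he : 𝔭.asIdeal.ramificationIdx (𝓞 ℚ) = 1) (hf : 𝔭.asIdeal.inertiaDeg (𝓞 ℚ) = 1) :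
    NumberField.discr K ≠ -3 := by
  have hspl : ((Ideal.span {((3 : ℕ) : ℤ)}).primesOver (𝓞 K)).ncard = 2 :=
    ncard_primesOver_eq_two_of_degreeOne hK.1 h𝔭 he hf
  have hnd : ¬ ((3 : ℕ) : ℤ) ∣ NumberField.discr K :=
    not_dvd_discr_of_ncard_primesOver Nat.prime_three (hspl.trans hK.1.symm)
  intro h
  exact hnd ⟨-1, by rw [h]; norm_num⟩

/-- **`D_K` odd is FREE for the kernel**: if the Heegner field `K` is chosen (Friedberg–Hoffstein with
prescribed splitting, `friedbergHoffstein_exists_heegnerField_splitDivisors_twist_ne_zero`) with `2 ∣ M`,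
then `2` splits in `K`, so `2 ∤ D_K` (tree `not_dvd_discr_of_ncard_primesOver`), i.e. `D_K` is odd — the
remaining half of BCS's (disc). [folklore] -/
theorem odd_discr_of_satisfiesHeegnerHypothesis_of_two_dvd {K : Type} [Field K] [NumberField K]
    (hK : IsImaginaryQuadratic K) {M : ℕ} (h2 : 2 ∣ M) (hH : SatisfiesHeegnerHypothesis M K) :
    Odd (NumberField.discr K) := by
  have hspl : ((Ideal.span {((2 : ℕ) : ℤ)}).primesOver (𝓞 K)).ncard = 2 := hH 2 Nat.prime_two h2
  have hnd : ¬ ((2 : ℕ) : ℤ) ∣ NumberField.discr K :=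
    not_dvd_discr_of_ncard_primesOver Nat.prime_two (hspl.trans hK.1.symm)
  refine Int.not_even_iff_odd.mp fun h ↦ hnd ?_
  exact_mod_cast even_iff_two_dvd.mp h

/-! ## §3 Crux #3 at `p = 3`: the `⊇`-half at EVERY frame for good-ordinary twins, and the reduction of
the crux on such twins to the `⊆`-half at ONE frame (conditional on the named fact `h421`) -/

/-- **The `⊇`-half of clause (ii) of crux #3 at EVERY frame, for a good-ordinary twin with (disc)** —
the crux's literal currency: for ALL `(Ω_K ≠ 0, Ω_p ≠ 0, L′)` with `IsBDPLFunction ι′ 𝔭 κ γ Dt′.f Ω_K Ω_p L′`,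
`(L′) ⊆ Ch_Λ(X_ac(W′_K) strict at 𝔭′)·R₀⟦T⟧`. From the printed frame (p533094,
`exists_frame_isTorsion_mem_charIdeal_of_goodOrd`, BCS 2025 Thm. 4.2.1 (b)) by cross-period rigidity
(§1). CONDITIONAL on `h421`. [cite: BurungaleCastellaSkinner2025, Thm. 4.2.1 (b) (§4.2, p. 8 of arXiv:2405.00270v2)] -/
theorem forall_frame_supset_of_goodOrd
    (h421 : BurungaleCastellaSkinner2025.thm421b_exists_isBDPLFunction_isTorsion_mem_charIdeal)
    (W' : WeierstrassCurve ℚ) [W'.IsElliptic] [W'.IsGloballyMinimal] (N' : ℕ) [NeZero N']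
    (K : Type) [Field K] [NumberField K] (Dt' : ModularParametrizationData W' N')
    (hord : GoodOrd W' 3) (hsurj : W'.HasSurjectiveModNGaloisRep 3)
    (hK : IsImaginaryQuadratic K) (hH : SatisfiesHeegnerHypothesis N' K)
    (hodd : Odd (NumberField.discr K))
    (κ : ZpExtension K 3) (hκ : κ.IsAnticyclotomic) (γ : absoluteGaloisGroup K)
    [hγ : Fact (κ.IsTopGenerator γ)]
    (𝔭 : HeightOneSpectrum (𝓞 K)) (h𝔭 : ((3 : ℕ) : 𝓞 K) ∈ 𝔭.asIdeal)
    (he : 𝔭.asIdeal.ramificationIdx (𝓞 ℚ) = 1) (hf : 𝔭.asIdeal.inertiaDeg (𝓞 ℚ) = 1)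
    (𝔭' : HeightOneSpectrum (𝓞 K)) (h𝔭' : ((3 : ℕ) : 𝓞 K) ∈ 𝔭'.asIdeal) (hne : 𝔭' ≠ 𝔭)
    (ι' : PadicAlgCl 3 ≃+* ℂ) (hι' : BranchInducesPrime 3 ι' 𝔭) :
    ∀ (ΩK : ℂ) (Ωp : ℂ_[3]) (L' : UnrSeries 3), ΩK ≠ 0 → Ωp ≠ 0 →
      IsBDPLFunction ι' 𝔭 κ γ Dt'.f ΩK Ωp L' →
      Ideal.span {L'} ≤ (AcSelmer.XAc.charIdeal (W'.baseChange K) 3 κ 𝔭' ∅ γ).map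
        (PowerSeries.map (toUnr 3)) := by
  intro ΩK Ωp L' hΩK hΩp hL'
  have hd3 : NumberField.discr K ≠ -3 := discr_ne_neg_three_of_degreeOne hK h𝔭 he hf
  obtain ⟨ΩK₀, Ωp₀, L₀, hΩK₀, hΩp₀, hL₀, hle⟩ := crux_conjunct_one_and_supset_at_frame_of_goodOrd h421
    W' N' K Dt' hord hsurj hK hH hodd hd3 κ hκ γ 𝔭 h𝔭 he hf 𝔭' h𝔭' hne ι' hι'
  rw [Ideal.span_singleton_le_iff_mem] at hle ⊢
  exact mem_of_frame_of_frame hK hκ hγ.out hΩK₀ hΩK hΩp₀ hΩp hL₀ hL' hle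

/-- **On a good-ordinary twin with (disc), crux #3 IS the `⊆`-half at ONE frame.** If for SOME frame
`(Ω_K ≠ 0, Ω_p ≠ 0, L₁)` of `f_{W′}` at `(ι′, 𝔭)` the divisibility `Ch_Λ(X_ac(W′_K) strict at 𝔭′)·R₀⟦T⟧ ⊆ (L₁)`
holds (the `p = 3` case of Wan's divisibility — "the only missing ingredient", BCS 2025 p. 5), then BOTH
conjuncts of `TwinSplitIMCAtThree` hold at `(W′, N′, K, Dt′, κ, γ, 𝔭, 𝔭′, ι′)`: (i) a frame exists and
(ii) EVERY frame `L′` has `Ch·R₀⟦T⟧ = (L′)`. (`⊇` at every frame: `forall_frame_supset_of_goodOrd`;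
`⊆` moves to every frame by §1.) CONDITIONAL on `h421`.
[cite: BurungaleCastellaSkinner2025, Thm. 4.2.1 (b) (§4.2, p. 8) and p. 5 (the `p = 3` gap) of arXiv:2405.00270v2] -/
theorem twinSplit_instance_of_goodOrd_of_subset_at_one_frame
    (h421 : BurungaleCastellaSkinner2025.thm421b_exists_isBDPLFunction_isTorsion_mem_charIdeal)
    (W' : WeierstrassCurve ℚ) [W'.IsElliptic] [W'.IsGloballyMinimal] (N' : ℕ) [NeZero N']
    (K : Type) [Field K] [NumberField K] (Dt' : ModularParametrizationData W' N')
    (hord : GoodOrd W' 3) (hsurj : W'.HasSurjectiveModNGaloisRep 3)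
    (hK : IsImaginaryQuadratic K) (hH : SatisfiesHeegnerHypothesis N' K)
    (hodd : Odd (NumberField.discr K))
    (κ : ZpExtension K 3) (hκ : κ.IsAnticyclotomic) (γ : absoluteGaloisGroup K)
    [hγ : Fact (κ.IsTopGenerator γ)]
    (𝔭 : HeightOneSpectrum (𝓞 K)) (h𝔭 : ((3 : ℕ) : 𝓞 K) ∈ 𝔭.asIdeal)
    (he : 𝔭.asIdeal.ramificationIdx (𝓞 ℚ) = 1) (hf : 𝔭.asIdeal.inertiaDeg (𝓞 ℚ) = 1)
    (𝔭' : HeightOneSpectrum (𝓞 K)) (h𝔭' : ((3 : ℕ) : 𝓞 K) ∈ 𝔭'.asIdeal) (hne : 𝔭' ≠ 𝔭)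
    (ι' : PadicAlgCl 3 ≃+* ℂ) (hι' : BranchInducesPrime 3 ι' 𝔭)
    (hsub : ∃ (ΩK : ℂ) (Ωp : ℂ_[3]) (L₁ : UnrSeries 3), ΩK ≠ 0 ∧ Ωp ≠ 0 ∧
      IsBDPLFunction ι' 𝔭 κ γ Dt'.f ΩK Ωp L₁ ∧
      (AcSelmer.XAc.charIdeal (W'.baseChange K) 3 κ 𝔭' ∅ γ).map (PowerSeries.map (toUnr 3)) ≤
        Ideal.span {L₁}) :
    (∃ (ΩK : ℂ) (Ωp : ℂ_[3]) (L' : UnrSeries 3), ΩK ≠ 0 ∧ Ωp ≠ 0 ∧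
        IsBDPLFunction ι' 𝔭 κ γ Dt'.f ΩK Ωp L') ∧
      (∀ (ΩK : ℂ) (Ωp : ℂ_[3]) (L' : UnrSeries 3), ΩK ≠ 0 → Ωp ≠ 0 →
        IsBDPLFunction ι' 𝔭 κ γ Dt'.f ΩK Ωp L' →
        (AcSelmer.XAc.charIdeal (W'.baseChange K) 3 κ 𝔭' ∅ γ).map (PowerSeries.map (toUnr 3)) =
          Ideal.span {L'}) := by
  obtain ⟨ΩK₁, Ωp₁, L₁, hΩK₁, hΩp₁, hL₁, hle₁⟩ := hsub
  refine ⟨⟨ΩK₁, Ωp₁, L₁, hΩK₁, hΩp₁, hL₁⟩, fun ΩK Ωp L' hΩK hΩp hL' ↦ le_antisymm ?_ ?_⟩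
  · exact le_span_of_frame_of_frame hK hκ hγ.out hΩK₁ hΩK hΩp₁ hΩp hL₁ hL' hle₁
  · exact forall_frame_supset_of_goodOrd h421 W' N' K Dt' hord hsurj hK hH hodd κ hκ γ 𝔭 h𝔭 he hf 𝔭'
      h𝔭' hne ι' hι' ΩK Ωp L' hΩK hΩp hL'

end Summit.BirchSwinnertonDyer.BirchSwinnertonDyer.Theorems.UniversalToricDescentTwinSplit

end
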